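import Summits.KontsevichZagierPeriods.KontsevichZagierPeriods.Theorems.RealOnePeriodRelations.Negative.Kit
import Literature.NumberTheory.Transcendental.KZTameMoveFamily
import Literature.NumberTheory.Transcendental.SemialgebraicLineDeriv

/-!
# `CurvePeriodsTransfer` (stmt-KontsevichZagierPeriods-11129) — negative knowledge, part 4: on normalised data rule (1b) is a consequence of Green + reflection

Support file for the crux `SymplecticScissors.CurvePeriodsTransfer` (cdisprove seat, cycle 2; work file
`Cruxes/CurvePeriodsTransfer/Disproof.lean`). Vocabulary (`greenSet`, `M₁`, `H₁`, `unitDom`) is the sibling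
kit `Theorems/RealOnePeriodRelations/Negative/Kit.lean`.

STRUCTURE OF THE CONCLUSION SUBGROUP `M₁ = closure (1a ∪ 1b ∪ 2 ∪ Green)`. Part 3 (`Negative/Consequent`)
showed that rule (2) CANNOT be dropped from `M₁` and that only dimension-one instances matter. Here, in the
opposite direction: on NORMALISED data — the shape every line for the crux reduces to: domain the open unit
interval, integrands continuous with `ℚ`-semialgebraic graph over the CLOSED unit interval — the
integrand-additivity move (1b) is REDUNDANT given the typed Green generator and ONE rule-(2) instance, the
reflection `t ↦ 1 − t`:

* `integrandAdd_mem_closure_cov_green` — for such `u, v` and any three representations `r, r₁, r₂` on the unit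
  interval with integrands `u + v, u, v` there: `[r] − [r₁] − [r₂] ∈ closure (changeOfVariablesRel ∪ greenSet)`.
  Mechanism: the SEPARABLE closed form `A da + B db` with `A = u(1 − a)`, `B = (u + v)(b)` is typed Green data
  (potential `S = −U(1 − a) + (U + V)(b)` on the open triangle, `U, V` primitives — transcendental in general,
  which the generator allows), and its three edge representations are `[u(1 − t)] + [v] − [u + v]`; the
  reflection identifies `[u(1 − t)]` with `[u]`.
* `of_add_of_neg_mem_closure_cov_green` — in particular `[u] + [−u] ≡ 0`, and `zeroLineRep_mem_greenSet`:
  the zero representation on the unit interval IS a Green instance (`A = B = S = 0`).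
* `of_sub_of_mem_changeOfVariablesRel` — extensionality modulo rule (2): representations with the same domain
  and integrands agreeing there differ by the identity instance (any dimension).

CONSEQUENCES FOR THE PROVERS (informative, not a weakening of the crux): (i) a realisation functional `Θ` may
use 1b freely on normalised pieces without enlarging the move set beyond `2 ∪ Green` — the bookkeeping
"`Θ` additive in the form / in the `ℚ̄`-scalar modulo `M₁`" (R1) costs nothing new; (ii) conversely the
typed Green generator is STRONG: together with reflection it linearises integrands, so any proposed
weakening of Green must be re-audited for this side effect; (iii) for the sibling compiler crux
`PlanarCompiler` (stmt-10058): every continuous-unit-interval 1b instance is already a (Green + reflection)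
chain, so `StackingShear` is implied by the compilation of Green cells and of the reflection shear.
[Kontsevich–Zagier 2001, §1.2]
-/

noncomputable section

open scoped BigOperators Topology
open Set MeasureTheory MvPolynomial intervalIntegral
open Literature.NumberTheory.Transcendental
open Literature.ModelTheory.ExponentialFields (IsSemialgebraic)
open Summit.KontsevichZagierPeriods.SymplecticScissors.RealOnePeriodRelationsNegative
  (greenSet M₁ H₁ unitDom isSemialgebraic_unitDom volume_unitDom measurableSet_unitDom)

namespace Summit.KontsevichZagierPeriods.SymplecticScissors.CurvePeriodsTransferNegative

/-! ## §1 Extensionality modulo rule (2) -/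

/-- The identity of `ℝⁿ` has determinant `1`. [folklore] -/
theorem det_id_eq_one (n : ℕ) : (ContinuousLinearMap.id ℝ (Fin n → ℝ)).det = 1 := by
  rw [ContinuousLinearMap.det, ContinuousLinearMap.coe_id, LinearMap.det_id]

/-- **Extensionality modulo rule (2).** Two representations with the same domain whose integrands agree
on it differ by the identity instance of the change-of-variables move. [cite: KontsevichZagier2001, §1.2] -/
theorem of_sub_of_mem_changeOfVariablesRel {n : ℕ} (r r' : KZ.IntegralRep n)
    (hd : r'.domain = r.domain) (hi : EqOn r.integrand r'.integrand r.domain) :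
    KZ.of r - KZ.of r' ∈ KZ.changeOfVariablesRel := by
  refine ⟨n, r, r', id, fun _ => ContinuousLinearMap.id ℝ _, isSemialgebraicMapOn_id r.isSemialgebraic_domain,
    fun x _ => (hasFDerivAt_id x).hasFDerivWithinAt, injOn_id _, by rw [image_id, hd], fun x hx => ?_, rfl⟩
  rw [det_id_eq_one, abs_one, mul_one]
  exact hi hx

/-! ## §2 Normalised line representations -/

/-- The closed unit interval as a subset of `ℝ¹`. [folklore] -/
def unitIcc : Set (Fin 1 → ℝ) := {z | z 0 ∈ Icc 0 1}

/-- `(0,1) ⊆ [0,1]` in `ℝ¹`. [folklore] -/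
theorem unitDom_subset_unitIcc : unitDom ⊆ unitIcc := fun _ hz => Ioo_subset_Icc_self hz

/-- `unitIcc` is `ℚ`-semialgebraic. [folklore] -/
theorem isSemialgebraic_unitIcc : IsSemialgebraic ℚ unitIcc := by
  have h0 := Literature.ModelTheory.ExponentialFields.isSemialgebraic_setOf_eval_nonneg (k := ℚ)
    (R := ℝ) (X (0 : Fin 1) : MvPolynomial (Fin 1) ℚ)
  have h1 := Literature.ModelTheory.ExponentialFields.isSemialgebraic_setOf_eval_le (k := ℚ)
    (R := ℝ) (X (0 : Fin 1) : MvPolynomial (Fin 1) ℚ) 1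
  have he : unitIcc = {z : Fin 1 → ℝ | 0 ≤ MvPolynomial.aeval z (X (0 : Fin 1) : MvPolynomial (Fin 1) ℚ)} ∩
      {z : Fin 1 → ℝ | MvPolynomial.aeval z (X (0 : Fin 1) : MvPolynomial (Fin 1) ℚ) ≤
        MvPolynomial.aeval z (1 : MvPolynomial (Fin 1) ℚ)} := by
    ext z
    simp [unitIcc]
  rw [he]
  exact h0.inter h1

/-- `unitIcc` is a coordinate cube. [folklore] -/
theorem unitIcc_eq_pi : unitIcc = Set.pi univ fun _ => Icc (0 : ℝ) 1 := by
  ext z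
  simp only [unitIcc, mem_setOf_eq, mem_univ_pi, mem_Icc, Fin.forall_fin_one]

/-- `unitIcc` is compact. [folklore] -/
theorem isCompact_unitIcc : IsCompact unitIcc := by
  rw [unitIcc_eq_pi]
  exact isCompact_univ_pi fun _ => isCompact_Icc

/-- NORMALISED DATA: a continuous function `h : ℝ → ℝ` whose graph over `[0,1]` is `ℚ`-semialgebraic.
(Every line for the crux normalises 1-dimensional representations to pieces of this shape.) [folklore] -/
structure LineData where
  /-- the integrand as a function of one real variable -/
  h : ℝ → ℝ
  /-- continuity on the whole line (only `[0,1]` matters; extend first if necessary) -/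
  continuous : Continuous h
  /-- the graph over the CLOSED unit interval is `ℚ`-semialgebraic -/
  isSemialgebraicFunOn : IsSemialgebraicFunOn ℚ unitIcc fun z => h (z 0)

namespace LineData

/-- The representation `[∫_{(0,1)} h]` of normalised data. [cite: KontsevichZagier2001, §1.1] -/
def rep (d : LineData) : KZ.IntegralRep 1 where
  domain := unitDom
  integrand := fun z => d.h (z 0)
  isSemialgebraic_domain := isSemialgebraic_unitDom
  isSemialgebraicFunOn_integrand := d.isSemialgebraicFunOn.mono unitDom_subset_unitIcc isSemialgebraic_unitDom
  integrableOn :=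
    ((d.continuous.comp (continuous_apply 0)).continuousOn.integrableOn_compact isCompact_unitIcc).mono_set
      unitDom_subset_unitIcc

/-- Domain of the line representation. [folklore] -/
@[simp] theorem rep_domain (d : LineData) : d.rep.domain = unitDom := rfl

/-- Integrand of the line representation. [folklore] -/
@[simp] theorem rep_integrand (d : LineData) (z : Fin 1 → ℝ) : d.rep.integrand z = d.h (z 0) := rfl

/-- Pull-back of the semialgebraicity datum along `t ↦ 1 − t`. [folklore] -/
theorem isSemialgebraicFunOn_refl (d : LineData) :
    IsSemialgebraicFunOn ℚ unitIcc fun z : Fin 1 → ℝ => d.h (1 - z 0) := by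
  have h := d.isSemialgebraicFunOn.comp_aeval (fun _ : Fin 1 => (1 - X 0 : MvPolynomial (Fin 1) ℚ))
  simp only [map_sub, map_one, aeval_X] at h
  refine h.mono (fun z hz => ?_) isSemialgebraic_unitIcc
  simp only [unitIcc, mem_setOf_eq, mem_Icc, mem_preimage] at hz ⊢
  constructor <;> linarith [hz.1, hz.2]

/-- Reflected data `t ↦ h (1 − t)`. [folklore] -/
def refl (d : LineData) : LineData where
  h := fun t => d.h (1 - t)
  continuous := d.continuous.comp (continuous_const.sub continuous_id)
  isSemialgebraicFunOn := d.isSemialgebraicFunOn_refl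

/-- Sum of data. [folklore] -/
def add (d e : LineData) : LineData where
  h := fun t => d.h t + e.h t
  continuous := d.continuous.add e.continuous
  isSemialgebraicFunOn := d.isSemialgebraicFunOn.fun_add e.isSemialgebraicFunOn

/-- Negated data. [folklore] -/
def neg (d : LineData) : LineData where
  h := fun t => -d.h t
  continuous := d.continuous.neg
  isSemialgebraicFunOn := d.isSemialgebraicFunOn.fun_neg

/-- Zero data. [folklore] -/
def zero : LineData where
  h := fun _ => 0
  continuous := continuous_const
  isSemialgebraicFunOn := by
    simpa using (RealOnePeriodRelationsNegative.isSemialgebraicFunOn_ratConst isSemialgebraic_unitIcc 0)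

/-- Unfolding of `refl`. [folklore] -/
@[simp] theorem refl_h (d : LineData) (t : ℝ) : d.refl.h t = d.h (1 - t) := rfl
/-- Unfolding of `add`. [folklore] -/
@[simp] theorem add_h (d e : LineData) (t : ℝ) : (d.add e).h t = d.h t + e.h t := rfl
/-- Unfolding of `neg`. [folklore] -/
@[simp] theorem neg_h (d : LineData) (t : ℝ) : d.neg.h t = -d.h t := rfl
/-- Unfolding of `zero`. [folklore] -/
@[simp] theorem zero_h (t : ℝ) : zero.h t = 0 := rfl

end LineData

/-! ## §3 The reflection `t ↦ 1 − t` is one rule-(2) instance -/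

/-- The reflection of `ℝ¹` in `½`. [folklore] -/
def reflMap : (Fin 1 → ℝ) → (Fin 1 → ℝ) := fun z _ => 1 - z 0

/-- Unfolding of `reflMap`. [folklore] -/
theorem reflMap_apply (z : Fin 1 → ℝ) (j : Fin 1) : reflMap z j = 1 - z 0 := rfl

/-- `reflMap` is an involution. [folklore] -/
theorem reflMap_reflMap (z : Fin 1 → ℝ) : reflMap (reflMap z) = z := by
  funext j
  rw [reflMap_apply, reflMap_apply, Subsingleton.elim j 0]
  ring

/-- `reflMap z = (1) − z`. [folklore] -/
theorem reflMap_eq_const_sub : reflMap = fun z => (fun _ => (1 : ℝ)) - z := by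
  funext z j
  rw [reflMap_apply, Pi.sub_apply, Subsingleton.elim j 0]

/-- `reflMap` preserves the open unit interval. [folklore] -/
theorem reflMap_mem_unitDom {z : Fin 1 → ℝ} (hz : z ∈ unitDom) : reflMap z ∈ unitDom := by
  simp only [unitDom, mem_setOf_eq, mem_Ioo, reflMap_apply] at hz ⊢
  constructor <;> linarith [hz.1, hz.2]

/-- `reflMap '' (0,1) = (0,1)`. [folklore] -/
theorem reflMap_image_unitDom : reflMap '' unitDom = unitDom := by
  refine Subset.antisymm ?_ fun z hz => ⟨reflMap z, reflMap_mem_unitDom hz, reflMap_reflMap z⟩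
  rintro _ ⟨z, hz, rfl⟩
  exact reflMap_mem_unitDom hz

/-- `reflMap` is a polynomial, hence `ℚ`-semialgebraic, map. [folklore] -/
theorem isSemialgebraicMapOn_reflMap : IsSemialgebraicMapOn ℚ unitDom reflMap := by
  refine (isSemialgebraicMapOn_aeval isSemialgebraic_unitDom
    (fun _ : Fin 1 => (1 - X 0 : MvPolynomial (Fin 1) ℚ))).congr fun z _ => ?_
  funext j
  simp [reflMap_apply]

/-- The derivative of `reflMap` is `−id`. [folklore] -/
theorem hasFDerivAt_reflMap (z : Fin 1 → ℝ) :
    HasFDerivAt reflMap (-(ContinuousLinearMap.id ℝ (Fin 1 → ℝ))) z := by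
  rw [reflMap_eq_const_sub]
  exact (hasFDerivAt_id (𝕜 := ℝ) z).const_sub _

/-- `|det (−id_{ℝ¹})| = 1`. [folklore] -/
theorem abs_det_neg_id_fin_one : |(-(ContinuousLinearMap.id ℝ (Fin 1 → ℝ))).det| = 1 := by
  have h : ((-(ContinuousLinearMap.id ℝ (Fin 1 → ℝ)) : (Fin 1 → ℝ) →L[ℝ] (Fin 1 → ℝ)) :
      (Fin 1 → ℝ) →ₗ[ℝ] (Fin 1 → ℝ)) = (-1 : ℝ) • LinearMap.id := by
    ext v j
    simp
  rw [ContinuousLinearMap.det, h, LinearMap.det_smul, LinearMap.det_id]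
  simp

/-- **Reflection is a move**: `[∫₀¹ h(t) dt] − [∫₀¹ h(1 − t) dt] ∈ changeOfVariablesRel`.
[cite: KontsevichZagier2001, §1.2] -/
theorem of_rep_sub_of_rep_refl_mem (d : LineData) :
    KZ.of d.rep - KZ.of d.refl.rep ∈ KZ.changeOfVariablesRel := by
  refine ⟨1, d.rep, d.refl.rep, reflMap, fun _ => -(ContinuousLinearMap.id ℝ (Fin 1 → ℝ)),
    isSemialgebraicMapOn_reflMap, fun z _ => (hasFDerivAt_reflMap z).hasFDerivWithinAt,
    fun x _ y _ h => by rw [← reflMap_reflMap x, h, reflMap_reflMap], ?_, fun z _ => ?_, rfl⟩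
  · rw [LineData.rep_domain, LineData.rep_domain, reflMap_image_unitDom]
  · rw [abs_det_neg_id_fin_one, mul_one, LineData.rep_integrand, LineData.rep_integrand, LineData.refl_h,
      reflMap_apply, sub_sub_cancel]

/-! ## §4 The separable Green instance -/

/-- The closed standard triangle is `ℚ`-semialgebraic. [folklore] -/
theorem isSemialgebraic_stdTriangle :
    IsSemialgebraic ℚ {p : Fin 2 → ℝ | 0 ≤ p 0 ∧ 0 ≤ p 1 ∧ p 0 + p 1 ≤ 1} := by
  have h0 := Literature.ModelTheory.ExponentialFields.isSemialgebraic_setOf_eval_nonneg (k := ℚ)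
    (R := ℝ) (X (0 : Fin 2) : MvPolynomial (Fin 2) ℚ)
  have h1 := Literature.ModelTheory.ExponentialFields.isSemialgebraic_setOf_eval_nonneg (k := ℚ)
    (R := ℝ) (X (1 : Fin 2) : MvPolynomial (Fin 2) ℚ)
  have h2 := Literature.ModelTheory.ExponentialFields.isSemialgebraic_setOf_eval_le (k := ℚ)
    (R := ℝ) (X (0 : Fin 2) + X 1 : MvPolynomial (Fin 2) ℚ) 1
  have he : {p : Fin 2 → ℝ | 0 ≤ p 0 ∧ 0 ≤ p 1 ∧ p 0 + p 1 ≤ 1} =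
      ({x : Fin 2 → ℝ | 0 ≤ MvPolynomial.aeval x (X (0 : Fin 2) : MvPolynomial (Fin 2) ℚ)} ∩
        {x : Fin 2 → ℝ | 0 ≤ MvPolynomial.aeval x (X (1 : Fin 2) : MvPolynomial (Fin 2) ℚ)}) ∩
      {x : Fin 2 → ℝ | MvPolynomial.aeval x (X (0 : Fin 2) + X 1 : MvPolynomial (Fin 2) ℚ) ≤
        MvPolynomial.aeval x (1 : MvPolynomial (Fin 2) ℚ)} := by
    ext p
    simp [and_assoc]
  rw [he]
  exact (h0.inter h1).inter h2

/-- `a ↦ h(1 − a)` is `ℚ`-semialgebraic on the closed triangle for normalised `h`. [folklore] -/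
theorem isSemialgebraicFunOn_triangle_refl_fst (d : LineData) :
    IsSemialgebraicFunOn ℚ {p : Fin 2 → ℝ | 0 ≤ p 0 ∧ 0 ≤ p 1 ∧ p 0 + p 1 ≤ 1} fun p => d.h (1 - p 0) := by
  have h := d.isSemialgebraicFunOn.comp_aeval (fun _ : Fin 1 => (1 - X 0 : MvPolynomial (Fin 2) ℚ))
  simp only [map_sub, map_one, aeval_X] at h
  refine h.mono (fun p hp => ?_) isSemialgebraic_stdTriangle
  simp only [mem_setOf_eq, mem_preimage, unitIcc, mem_Icc] at hp ⊢
  constructor <;> linarith [hp.1, hp.2.1, hp.2.2]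

/-- `b ↦ h(b)` is `ℚ`-semialgebraic on the closed triangle for normalised `h`. [folklore] -/
theorem isSemialgebraicFunOn_triangle_snd (d : LineData) :
    IsSemialgebraicFunOn ℚ {p : Fin 2 → ℝ | 0 ≤ p 0 ∧ 0 ≤ p 1 ∧ p 0 + p 1 ≤ 1} fun p => d.h (p 1) := by
  have h := d.isSemialgebraicFunOn.comp_aeval (fun _ : Fin 1 => (X 1 : MvPolynomial (Fin 2) ℚ))
  simp only [aeval_X] at h
  refine h.mono (fun p hp => ?_) isSemialgebraic_stdTriangle
  simp only [mem_setOf_eq, mem_preimage, unitIcc, mem_Icc] at hp ⊢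
  constructor <;> linarith [hp.1, hp.2.1, hp.2.2]

/-- **The separable Green instance.** For normalised `u, w`: `[u(1 − t)] + [w − u] − [w]`-shaped — precisely
`[∫₀¹ u(1−t)] + [∫₀¹ (w − u)(t)… ]`: with `A = u(1 − a)`, `B = w(b)` the three edge representations of the
typed generator are `r₀₁ = [u(1 − t)]`, `r₁₂ = [w(t) − u(t)]`, `r₀₂ = [w(t)]`. We use it with `w = u + v`,
where `r₁₂ = [v]`. [cite: KontsevichZagier2001, §1.2] -/
theorem green_separable_mem (d e : LineData) :
    KZ.of d.refl.rep + KZ.of e.rep - KZ.of (d.add e).rep ∈ greenSet := by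
  -- primitives
  set U : ℝ → ℝ := fun x => ∫ s in (0 : ℝ)..x, d.h s with hU
  set W : ℝ → ℝ := fun x => ∫ s in (0 : ℝ)..x, (d.add e).h s with hW
  have hUd : ∀ x, HasDerivAt U (d.h x) x := fun x => (d.continuous.integral_hasStrictDerivAt 0 x).hasDerivAt
  have hWd : ∀ x, HasDerivAt W ((d.add e).h x) x := fun x =>
    ((d.add e).continuous.integral_hasStrictDerivAt 0 x).hasDerivAt
  refine ⟨_, fun p => d.h (1 - p 0), fun p => (d.add e).h (p 1), fun p => -U (1 - p 0) + W (p 1),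
    d.refl.rep, e.rep, (d.add e).rep, rfl, isSemialgebraicFunOn_triangle_refl_fst d,
    isSemialgebraicFunOn_triangle_snd (d.add e), ?_, ?_, ?_, rfl, rfl, rfl, ?_, ?_, ?_, rfl⟩
  · exact (d.continuous.comp (continuous_const.sub (continuous_apply 0))).continuousOn
  · exact ((d.add e).continuous.comp (continuous_apply 1)).continuousOn
  · intro p _ _ _
    have h0 : HasFDerivAt (fun p : Fin 2 → ℝ => 1 - p 0)
        (-(ContinuousLinearMap.proj (R := ℝ) (φ := fun _ : Fin 2 => ℝ) 0)) p :=
      (ContinuousLinearMap.proj (R := ℝ) (φ := fun _ : Fin 2 => ℝ) 0).hasFDerivAt.const_sub 1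
    have h1 : HasFDerivAt (fun p : Fin 2 → ℝ => p 1)
        (ContinuousLinearMap.proj (R := ℝ) (φ := fun _ : Fin 2 => ℝ) 1) p :=
      (ContinuousLinearMap.proj (R := ℝ) (φ := fun _ : Fin 2 => ℝ) 1).hasFDerivAt
    have hA := ((hUd (1 - p 0)).comp_hasFDerivAt p h0).neg
    have hB := (hWd (p 1)).comp_hasFDerivAt p h1
    refine (hA.add hB).congr_fderiv (ContinuousLinearMap.ext fun v => ?_)
    simp
  · intro z _
    simp [LineData.rep_integrand]
  · intro z _
    simp only [LineData.rep_integrand, LineData.add_h, Matrix.cons_val_one, Matrix.cons_val_zero,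
      sub_sub_cancel]
    ring
  · intro z _
    simp [LineData.rep_integrand]

/-! ## §5 Rule (1b) on normalised data from Green + reflection -/

/-- **1b for normalised data is a (Green + reflection) chain**: `[u + v] − [u] − [v] ∈ closure (2 ∪ Green)`
for the line representations of normalised data. [cite: KontsevichZagier2001, §1.2] -/
theorem of_add_rep_sub_mem (d e : LineData) :
    KZ.of (d.add e).rep - KZ.of d.rep - KZ.of e.rep ∈ AddSubgroup.closure (KZ.changeOfVariablesRel ∪ greenSet) := by
  have hg : _ ∈ AddSubgroup.closure (KZ.changeOfVariablesRel ∪ greenSet) :=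
    AddSubgroup.subset_closure (Or.inr (green_separable_mem d e))
  have hρ : _ ∈ AddSubgroup.closure (KZ.changeOfVariablesRel ∪ greenSet) :=
    AddSubgroup.subset_closure (Or.inl (of_rep_sub_of_rep_refl_mem d))
  have key : KZ.of (d.add e).rep - KZ.of d.rep - KZ.of e.rep =
      -(KZ.of d.refl.rep + KZ.of e.rep - KZ.of (d.add e).rep) - (KZ.of d.rep - KZ.of d.refl.rep) := by abel
  rw [key]
  exact sub_mem (neg_mem hg) hρ

/-- **Rule (1b) is redundant on normalised data.** For continuous `u, v : ℝ → ℝ` with `ℚ`-semialgebraic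
graphs over `[0,1]` and ANY three 1-dimensional representations on the open unit interval with integrands
`u + v`, `u`, `v` there, the 1b element `[r] − [r₁] − [r₂]` lies in `closure (changeOfVariablesRel ∪ greenSet)`
— no 1b, no 1a. [cite: KontsevichZagier2001, §1.2] -/
theorem integrandAdd_mem_closure_cov_green (d e : LineData) (r r₁ r₂ : KZ.IntegralRep 1)
    (hr : r.domain = unitDom) (hr₁ : r₁.domain = unitDom) (hr₂ : r₂.domain = unitDom)
    (hi : ∀ z ∈ unitDom, r.integrand z = d.h (z 0) + e.h (z 0))
    (hi₁ : ∀ z ∈ unitDom, r₁.integrand z = d.h (z 0)) (hi₂ : ∀ z ∈ unitDom, r₂.integrand z = e.h (z 0)) :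
    KZ.of r - KZ.of r₁ - KZ.of r₂ ∈ AddSubgroup.closure (KZ.changeOfVariablesRel ∪ greenSet) := by
  have ι₀ : KZ.of r - KZ.of (d.add e).rep ∈ KZ.changeOfVariablesRel :=
    of_sub_of_mem_changeOfVariablesRel r (d.add e).rep (by rw [hr]; rfl) fun z hz => by
      rw [hr] at hz; simpa using hi z hz
  have ι₁ : KZ.of r₁ - KZ.of d.rep ∈ KZ.changeOfVariablesRel :=
    of_sub_of_mem_changeOfVariablesRel r₁ d.rep (by rw [hr₁]; rfl) fun z hz => by
      rw [hr₁] at hz; simpa using hi₁ z hz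
  have ι₂ : KZ.of r₂ - KZ.of e.rep ∈ KZ.changeOfVariablesRel :=
    of_sub_of_mem_changeOfVariablesRel r₂ e.rep (by rw [hr₂]; rfl) fun z hz => by
      rw [hr₂] at hz; simpa using hi₂ z hz
  have h := of_add_rep_sub_mem d e
  have key : KZ.of r - KZ.of r₁ - KZ.of r₂ = (KZ.of r - KZ.of (d.add e).rep) - (KZ.of r₁ - KZ.of d.rep) -
      (KZ.of r₂ - KZ.of e.rep) + (KZ.of (d.add e).rep - KZ.of d.rep - KZ.of e.rep) := by abel
  rw [key]
  refine add_mem (sub_mem (sub_mem ?_ ?_) ?_) h <;>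
    exact AddSubgroup.subset_closure (Or.inl ‹_›)

/-- The zero representation on the unit interval IS a Green instance (`A = B = S = 0`, all three edge
representations equal to it). [cite: KontsevichZagier2001, §1.2] -/
theorem zeroLineRep_mem_greenSet : KZ.of LineData.zero.rep ∈ greenSet := by
  refine ⟨_, fun _ => 0, fun _ => 0, fun _ => 0, LineData.zero.rep, LineData.zero.rep, LineData.zero.rep, rfl,
    ?_, ?_, continuousOn_const, continuousOn_const, ?_, rfl, rfl, rfl, ?_, ?_, ?_, by abel⟩
  · simpa using RealOnePeriodRelationsNegative.isSemialgebraicFunOn_ratConst isSemialgebraic_stdTriangle 0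
  · simpa using RealOnePeriodRelationsNegative.isSemialgebraicFunOn_ratConst isSemialgebraic_stdTriangle 0
  · intro p _ _ _
    refine (hasFDerivAt_const (𝕜 := ℝ) (0 : ℝ) p).congr_fderiv (ContinuousLinearMap.ext fun v => ?_)
    simp
  · intro z _; simp
  · intro z _; simp
  · intro z _; simp

/-- **Negation is a (Green + reflection) chain**: `[u] + [−u] ∈ closure (2 ∪ Green)` on normalised data.
[cite: KontsevichZagier2001, §1.2] -/
theorem of_rep_add_of_neg_rep_mem (d : LineData) :
    KZ.of d.rep + KZ.of d.neg.rep ∈ AddSubgroup.closure (KZ.changeOfVariablesRel ∪ greenSet) := by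
  have h := integrandAdd_mem_closure_cov_green d d.neg LineData.zero.rep d.rep d.neg.rep rfl rfl rfl
    (fun z _ => by simp) (fun z _ => rfl) (fun z _ => rfl)
  have h0 : KZ.of LineData.zero.rep ∈ AddSubgroup.closure (KZ.changeOfVariablesRel ∪ greenSet) :=
    AddSubgroup.subset_closure (Or.inr zeroLineRep_mem_greenSet)
  have key : KZ.of d.rep + KZ.of d.neg.rep =
      KZ.of LineData.zero.rep - (KZ.of LineData.zero.rep - KZ.of d.rep - KZ.of d.neg.rep) := by abel
  rw [key]
  exact sub_mem h0 h

/-- The subgroup `closure (2 ∪ Green)` is contained in `M₁` (so the chains above are chains of the crux's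
conclusion subgroup). [folklore] -/
theorem closure_cov_green_le_M₁ : AddSubgroup.closure (KZ.changeOfVariablesRel ∪ greenSet) ≤ M₁ :=
  AddSubgroup.closure_mono (by
    rintro c (hc | hc)
    · exact Or.inl (Or.inr hc)
    · exact Or.inr hc)

end Summit.KontsevichZagierPeriods.SymplecticScissors.CurvePeriodsTransferNegative

end
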